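import Summits.QuantumFields.YangMills.Theorems.LangevinControlUVFemtoCurvatureTwoPointStubDoublingOfRV
import Summits.QuantumFields.YangMills.Theorems.BalabanLadderIRStubRungStrong
import Literature.MathematicalPhysics.QuantumFieldTheory.LatticeGaugeShenZhuZhuProofs
import HarnessLib

/-!
# `IR` — KERNEL-LEVEL LARGE-FIELD RARITY, uniform in the exterior (Gaussian lower bound + Chebyshev)

Spine route `BalabanLadder` (route-QuantumFields-BalabanLadder), crux `IR` (stmt-QuantumFields-19354), registered line
«af-pincer-T» (skeleton 0308f95ca6f6a115).  The companions `…IRHereditaryUpgrade` / `…IRTorusUpgrade` reduce clauses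
(ii_T)/(iii_T) of `AfPincerT.TypShellCond` to SINGLE-CELL sup-`ζ` rarity under the lattice Yang–Mills kernels; this
file supplies the basic kernel-level estimate from which such rarity is obtained for THRESHOLD statistics (owner
READING R37 (b): «bulk statistics … sup-ζ single-cell rarity», «type dilute as density ≤ K log β∕β in every sub-cube of
side L₀»).  Count-neutral helper (`--supports stmt-QuantumFields-19354 --as helper`); no stub claimed, no skeleton
touched.

## Objects

* `plaqsIn E` — the plaquettes all of whose four edges lie in the finite edge set `E` (the plaquettes «of» `E`; the
  other plaquettes touching `E` are its boundary plaquettes, `#(plaquettesTouching E) − #(plaqsIn E)` of them);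
* `actionIn ρ E U = Σ_{p ∈ plaqsIn E} (N − Re tr ρ(U_p))` — the Wilson action of `E` WITHOUT boundary terms (a cylinder
  on `E`).

## Statement (`kernel_measureReal_le_actionIn_le`, `kernel_apply_le_actionIn_le`, `…_of_subset`)

For a continuous unitary representation `ρ` of a compact second-countable group, `β ≥ 0`, a finite edge set `E`, ANY
exterior `η`, a radius `δ` and a mass `m > 0` with `Haar{‖ρ g − 1‖ ≤ δ} ≥ m`, and any threshold `T`:
`γ_E(· | η){U | T ≤ actionIn ρ E U} ≤ exp(β (8 δ² n_in + 2N n_bd) − β T) / m ^ #E`,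
`n_in = #(plaqsIn E)`, `n_bd = #(plaquettesTouching E) − n_in`.  By DLR consistency the same bound holds for the
event read inside any LARGER kernel `γ_Λ(· | ζ)`, `E ⊆ Λ`, uniformly in `ζ` (`…_of_subset`; Hausdorff `G`).  With the
small-ball constant of the tree's exponential-chart package (`FreeEnergyLogCoefficient.exists_haar_gball_ge`:
`Haar{‖r g − 1‖ ≤ δ} ≥ C₁ δ^D`, `D = dimE r.ρ`, faithful `r`) and `δ = β^{-1/2}`:
`≤ exp(8 n_in + 2Nβ n_bd − βT) · (C₁ β^{−D/2})^{−#E}` (`kernel_measureReal_le_actionIn_le_rep`).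

## Proof

Kernel integral formula (`Tempered.integral_ymSpecification_of_continuous`): `γ_E(A | η) = (∫ 1_A e^{−βS_E})/(∫ e^{−βS_E})`
over product Haar on the links of `E`.  Numerator: on `A = {T ≤ actionIn}` the full boundary action satisfies
`S_E ≥ actionIn ≥ T` (all plaquette energies are `≥ 0` for unitary `ρ`), so it is `≤ e^{−βT}`.  Denominator: on the
product ball `{∀ e ∈ E, ‖ρ(U_e) − 1‖ ≤ δ}` (product-Haar mass `≥ m^{#E}`) every plaquette of `E` has
`‖ρ(U_p) − 1‖ ≤ 4δ`, energy `≤ 8δ²` (`DoublingOfRV.sub_re_trace_le`), and every boundary plaquette has energy `≤ 2N`,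
so it is `≥ e^{−β(8δ² n_in + 2N n_bd)} m^{#E}` — the tree's crude Gaussian lower bound for the torus partition function
(`DoublingOfRV.exp_mul_pow_le_partitionFunction_toReal`) transplanted to a kernel with boundary condition.

Everything here is proved (no `sorry`, no new axioms).  HONEST FRAMING: an elementary energy–entropy bound at the
scale of the resampled volume (useful for BULK threshold statistics of sub-boxes, void for surface/layer statistics,
exactly as the owner's typing datum R37 (b) says); (i_T) and the bridge carry the IR weight; conditional chain
untouched; not a gap, not Clay.  Refs: Georgii 2011 Def. 2.9, (1.21); Seiler LNP 159 Ch. 2; folklore.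
-/

set_option autoImplicit false

noncomputable section

open MeasureTheory
open scoped ENNReal Matrix.Norms.Frobenius
open Literature.Probability.LatticeModels
open Literature.MathematicalPhysics.QuantumLattice
open Literature.MathematicalPhysics.QuantumFieldTheory (haarProbability LatticeRep isSpecification_ymSpecification_of_t2Space)
open Summit.QuantumFields.YangMills.Theorems.FreeEnergyLogCoefficient (dimE exists_haar_gball_ge)
open Summit.QuantumFields.YangMills.Theorems.FemtoCurvatureTwoPoint.DoublingOfRV
  (norm_rho_mul_sub_one_le norm_rho_inv_sub_one sub_re_trace_le)
open Summit.QuantumFields.YangMills.Cruxes.IR.Tempered (integral_ymSpecification_of_continuous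
  measurable_wilsonWeight_of_continuous)

namespace Summit.QuantumFields.YangMills.Theorems.IRKernelLargeField

/-! ## §1 The plaquettes of an edge set and their action -/

section Objects

variable {d : ℕ} {G : Type*} [Group G] {N : ℕ} (ρ : G →* Matrix (Fin N) (Fin N) ℂ)

/-- The plaquettes all of whose four edges lie in `E`. -/
def plaqsIn (E : Finset (ZdEdge d)) : Finset (ZdPlaquette d) :=
  (plaquettesTouching E).filter fun p => plaquetteEdges p ⊆ E

/-- The Wilson action of the plaquettes of `E` (no boundary terms): `Σ_{p ∈ plaqsIn E} (N − Re tr ρ(U_p))`. -/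
def actionIn (E : Finset (ZdEdge d)) (U : LGConfig d G) : ℝ :=
  ∑ p ∈ plaqsIn E, ((N : ℝ) - plaquetteObs ρ p.1 p.2.1.1 p.2.1.2 U)

/-- The plaquettes of `E` touch `E`. -/
theorem plaqsIn_subset (E : Finset (ZdEdge d)) : plaqsIn E ⊆ plaquettesTouching E := Finset.filter_subset _ _

/-- The four edges of a plaquette of `E` lie in `E`. -/
theorem plaquetteEdges_subset_of_mem_plaqsIn {E : Finset (ZdEdge d)} {p : ZdPlaquette d} (hp : p ∈ plaqsIn E) :
    plaquetteEdges p ⊆ E :=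
  (Finset.mem_filter.1 hp).2

/-- A plaquette energy is nonnegative (unitary `ρ`). -/
theorem sub_plaquetteObs_nonneg (hU : ∀ g, ρ g ∈ Matrix.unitaryGroup (Fin N) ℂ) (x : Site d) (i j : Fin d)
    (U : LGConfig d G) : 0 ≤ (N : ℝ) - plaquetteObs ρ x i j U := by
  have h := abs_le.1 (abs_plaquetteObs_le_holds (d := d) ρ hU x i j U)
  linarith [h.2]

/-- A plaquette energy is at most `2N` (unitary `ρ`). -/
theorem sub_plaquetteObs_le (hU : ∀ g, ρ g ∈ Matrix.unitaryGroup (Fin N) ℂ) (x : Site d) (i j : Fin d)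
    (U : LGConfig d G) : (N : ℝ) - plaquetteObs ρ x i j U ≤ 2 * N := by
  have h := abs_le.1 (abs_plaquetteObs_le_holds (d := d) ρ hU x i j U)
  linarith [h.1]

/-- `actionIn` is nonnegative. -/
theorem actionIn_nonneg (hU : ∀ g, ρ g ∈ Matrix.unitaryGroup (Fin N) ℂ) (E : Finset (ZdEdge d))
    (U : LGConfig d G) : 0 ≤ actionIn ρ E U :=
  Finset.sum_nonneg fun _ _ => sub_plaquetteObs_nonneg ρ hU _ _ _ U

/-- The action of the plaquettes of `E` is at most the full boundary Wilson action `S_E`. -/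
theorem actionIn_le_wilsonBoundaryAction (hU : ∀ g, ρ g ∈ Matrix.unitaryGroup (Fin N) ℂ) (E : Finset (ZdEdge d))
    (U : LGConfig d G) : actionIn ρ E U ≤ wilsonBoundaryAction ρ E U :=
  Finset.sum_le_sum_of_subset_of_nonneg (plaqsIn_subset E) fun _ _ _ => sub_plaquetteObs_nonneg ρ hU _ _ _ U

/-- `actionIn ρ E` is a cylinder on `E`. -/
theorem dependsOn_actionIn (E : Finset (ZdEdge d)) : DependsOn (actionIn (G := G) ρ E) (↑E : Set (ZdEdge d)) := by
  intro U V hUV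
  refine Finset.sum_congr rfl fun p hp => ?_
  rw [isCylinder_plaquetteObs ρ p fun e he => hUV e (plaquetteEdges_subset_of_mem_plaqsIn hp he)]

variable [TopologicalSpace G] [IsTopologicalGroup G] [MeasurableSpace G] [BorelSpace G] [SecondCountableTopology G]

/-- `actionIn ρ E` is measurable (continuous `ρ`, second-countable `G`). -/
theorem measurable_actionIn (hρ : Continuous ρ) (E : Finset (ZdEdge d)) : Measurable (actionIn (G := G) ρ E) := by
  refine Finset.measurable_sum _ fun p _ => measurable_const.sub ?_
  have : Continuous (plaquetteObs (G := G) ρ p.1 p.2.1.1 p.2.1.2) := by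
    unfold plaquetteObs plaquetteHolonomyZd
    fun_prop
  exact this.measurable

/-- The large-action event is measurable. -/
theorem measurableSet_le_actionIn (hρ : Continuous ρ) (E : Finset (ZdEdge d)) (T : ℝ) :
    MeasurableSet {U : LGConfig d G | T ≤ actionIn ρ E U} :=
  measurableSet_le measurable_const (measurable_actionIn ρ hρ E)

end Objects

/-! ## §2 The action on the product ball -/

section Ball

variable {d : ℕ} {G : Type*} [Group G] {N : ℕ} (ρ : G →* Matrix (Fin N) (Fin N) ℂ)

/-- On a configuration whose links in `E` are `δ`-close to `1` (through `ρ`), every plaquette of `E` has holonomy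
`4δ`-close to `1`. -/
theorem norm_rho_holonomy_sub_one_le (hU : ∀ g, ρ g ∈ Matrix.unitaryGroup (Fin N) ℂ) {E : Finset (ZdEdge d)}
    {U : LGConfig d G} {δ : ℝ} (hδ : ∀ e ∈ E, ‖ρ (U e) - 1‖ ≤ δ) {p : ZdPlaquette d} (hp : p ∈ plaqsIn E) :
    ‖ρ (plaquetteHolonomyZd U p.1 p.2.1.1 p.2.1.2) - 1‖ ≤ 4 * δ := by
  have hE := plaquetteEdges_subset_of_mem_plaqsIn hp
  have h1 : ‖ρ (U (p.1, p.2.1.1)) - 1‖ ≤ δ := hδ _ (hE (by simp [plaquetteEdges]))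
  have h2 : ‖ρ (U (p.1 + Pi.single p.2.1.1 1, p.2.1.2)) - 1‖ ≤ δ := hδ _ (hE (by simp [plaquetteEdges]))
  have h3 : ‖ρ (U (p.1 + Pi.single p.2.1.2 1, p.2.1.1))⁻¹ - 1‖ ≤ δ := by
    rw [norm_rho_inv_sub_one ρ hU]; exact hδ _ (hE (by simp [plaquetteEdges]))
  have h4 : ‖ρ (U (p.1, p.2.1.2))⁻¹ - 1‖ ≤ δ := by
    rw [norm_rho_inv_sub_one ρ hU]; exact hδ _ (hE (by simp [plaquetteEdges]))
  unfold plaquetteHolonomyZd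
  calc ‖ρ (U (p.1, p.2.1.1) * U (p.1 + Pi.single p.2.1.1 1, p.2.1.2) * (U (p.1 + Pi.single p.2.1.2 1, p.2.1.1))⁻¹ *
          (U (p.1, p.2.1.2))⁻¹) - 1‖
      ≤ ‖ρ (U (p.1, p.2.1.1) * U (p.1 + Pi.single p.2.1.1 1, p.2.1.2) *
            (U (p.1 + Pi.single p.2.1.2 1, p.2.1.1))⁻¹) - 1‖ + ‖ρ (U (p.1, p.2.1.2))⁻¹ - 1‖ :=
        norm_rho_mul_sub_one_le ρ hU _ _
    _ ≤ ‖ρ (U (p.1, p.2.1.1) * U (p.1 + Pi.single p.2.1.1 1, p.2.1.2)) - 1‖ +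
          ‖ρ (U (p.1 + Pi.single p.2.1.2 1, p.2.1.1))⁻¹ - 1‖ + ‖ρ (U (p.1, p.2.1.2))⁻¹ - 1‖ := by
        gcongr; exact norm_rho_mul_sub_one_le ρ hU _ _
    _ ≤ ‖ρ (U (p.1, p.2.1.1)) - 1‖ + ‖ρ (U (p.1 + Pi.single p.2.1.1 1, p.2.1.2)) - 1‖ +
          ‖ρ (U (p.1 + Pi.single p.2.1.2 1, p.2.1.1))⁻¹ - 1‖ + ‖ρ (U (p.1, p.2.1.2))⁻¹ - 1‖ := by
        gcongr; exact norm_rho_mul_sub_one_le ρ hU _ _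
    _ ≤ δ + δ + δ + δ := by gcongr
    _ = 4 * δ := by ring

/-- **The boundary Wilson action on the product ball.**  If every link of `E` is `δ`-close to `1` through `ρ`, then
`S_E(U) ≤ 8 δ² n_in + 2N n_bd` (plaquettes of `E`: energy `≤ 8δ²`; boundary plaquettes: energy `≤ 2N`). -/
theorem wilsonBoundaryAction_le_of_ball (hU : ∀ g, ρ g ∈ Matrix.unitaryGroup (Fin N) ℂ) (E : Finset (ZdEdge d))
    {U : LGConfig d G} {δ : ℝ} (hδ : ∀ e ∈ E, ‖ρ (U e) - 1‖ ≤ δ) :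
    wilsonBoundaryAction ρ E U ≤
      8 * δ ^ 2 * (plaqsIn E).card + 2 * N * ((plaquettesTouching E).card - (plaqsIn E).card) := by
  classical
  unfold wilsonBoundaryAction
  rw [← Finset.sum_filter_add_sum_filter_not (plaquettesTouching E) (fun p => plaquetteEdges p ⊆ E)]
  have hin : ∑ p ∈ (plaquettesTouching E).filter (fun p => plaquetteEdges p ⊆ E),
      ((N : ℝ) - plaquetteObs ρ p.1 p.2.1.1 p.2.1.2 U) ≤ 8 * δ ^ 2 * (plaqsIn E).card := by
    calc ∑ p ∈ (plaquettesTouching E).filter (fun p => plaquetteEdges p ⊆ E),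
          ((N : ℝ) - plaquetteObs ρ p.1 p.2.1.1 p.2.1.2 U)
        ≤ ∑ _p ∈ (plaquettesTouching E).filter (fun p => plaquetteEdges p ⊆ E), 8 * δ ^ 2 :=
          Finset.sum_le_sum fun p hp => by
            have h := sub_re_trace_le ρ hU _ (norm_rho_holonomy_sub_one_le ρ hU hδ hp)
            have e : (4 * δ) ^ 2 / 2 = 8 * δ ^ 2 := by ring
            unfold plaquetteObs
            linarith
      _ = 8 * δ ^ 2 * (plaqsIn E).card := by
          rw [Finset.sum_const, nsmul_eq_mul, mul_comm]; rfl
  have hbd : ∑ p ∈ (plaquettesTouching E).filter (fun p => ¬ plaquetteEdges p ⊆ E),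
      ((N : ℝ) - plaquetteObs ρ p.1 p.2.1.1 p.2.1.2 U) ≤ 2 * N * ((plaquettesTouching E).card - (plaqsIn E).card) := by
    calc ∑ p ∈ (plaquettesTouching E).filter (fun p => ¬ plaquetteEdges p ⊆ E),
          ((N : ℝ) - plaquetteObs ρ p.1 p.2.1.1 p.2.1.2 U)
        ≤ ∑ _p ∈ (plaquettesTouching E).filter (fun p => ¬ plaquetteEdges p ⊆ E), 2 * (N : ℝ) :=
          Finset.sum_le_sum fun p _ => sub_plaquetteObs_le ρ hU _ _ _ U
      _ = 2 * N * ((plaquettesTouching E).card - (plaqsIn E).card) := by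
          rw [Finset.sum_const, nsmul_eq_mul, mul_comm]
          congr 1
          have h := Finset.card_filter_add_card_filter_not (s := plaquettesTouching E)
            (fun p => plaquetteEdges p ⊆ E)
          have : ((plaquettesTouching E).filter (fun p => ¬ plaquetteEdges p ⊆ E)).card =
              (plaquettesTouching E).card - (plaqsIn E).card := by
            unfold plaqsIn; omega
          rw [this, Nat.cast_sub (Finset.card_le_card (plaqsIn_subset E))]
  linarith

end Ball

/-! ## §3 The kernel estimate -/

section Kernel

variable {d : ℕ} {G : Type*} [Group G] [TopologicalSpace G] [IsTopologicalGroup G] [CompactSpace G]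
  [MeasurableSpace G] [BorelSpace G] [SecondCountableTopology G]
  {N : ℕ} (ρ : G →* Matrix (Fin N) (Fin N) ℂ)

omit [SecondCountableTopology G] in
/-- The product ball has product-Haar mass at least `m ^ #E`. -/
theorem pow_le_measureReal_pi_ball (E : Finset (ZdEdge d)) {δ m : ℝ} (hm : 0 ≤ m)
    (hball : ENNReal.ofReal m ≤ haarProbability G {g : G | ‖ρ g - 1‖ ≤ δ}) :
    m ^ E.card ≤ (Measure.pi fun _ : ↥E => haarProbability G).real
      (Set.pi Set.univ fun _ : ↥E => {g : G | ‖ρ g - 1‖ ≤ δ}) := by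
  have h1 : m ≤ (haarProbability G {g : G | ‖ρ g - 1‖ ≤ δ}).toReal :=
    (ENNReal.ofReal_le_iff_le_toReal (measure_ne_top _ _)).1 hball
  rw [measureReal_def, Measure.pi_pi, Finset.prod_const, Finset.card_univ, Fintype.card_coe, ENNReal.toReal_pow]
  exact pow_le_pow_left₀ hm h1 _

/-- **Kernel-level large-field rarity, uniform in the exterior.**  For a continuous unitary representation `ρ`,
`β ≥ 0`, a finite edge set `E`, any exterior `η`, a radius `δ` with `Haar{‖ρ g − 1‖ ≤ δ} ≥ m > 0` and any `T`:
`γ_E(· | η){T ≤ actionIn ρ E} ≤ exp(β(8δ² n_in + 2N n_bd) − βT) / m^{#E}` (`measureReal` form). -/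
theorem kernel_measureReal_le_actionIn_le (hρ : Continuous ρ) (hU : ∀ g, ρ g ∈ Matrix.unitaryGroup (Fin N) ℂ)
    {β : ℝ} (hβ : 0 ≤ β) (E : Finset (ZdEdge d)) (η : LGConfig d G) {δ m : ℝ} (hm : 0 < m)
    (hball : ENNReal.ofReal m ≤ haarProbability G {g : G | ‖ρ g - 1‖ ≤ δ}) (T : ℝ) :
    (ymSpecification ρ β E η).real {U : LGConfig d G | T ≤ actionIn ρ E U} ≤
      Real.exp (β * (8 * δ ^ 2 * (plaqsIn E).card + 2 * N * ((plaquettesTouching E).card - (plaqsIn E).card)) -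
          β * T) / m ^ E.card := by
  classical
  set A : Set (LGConfig d G) := {U | T ≤ actionIn ρ E U} with hAdef
  have hA : MeasurableSet A := measurableSet_le_actionIn ρ hρ E T
  set π : Measure (↥E → G) := Measure.pi fun _ : ↥E => haarProbability G with hπ
  set K : ℝ := 8 * δ ^ 2 * (plaqsIn E).card + 2 * N * ((plaquettesTouching E).card - (plaqsIn E).card) with hK
  set w : LGConfig d G → ℝ := fun U => Real.exp (-β * wilsonBoundaryAction ρ E U) with hw
  have hwm : Measurable w := measurable_wilsonWeight_of_continuous ρ hρ β E
  have hg : Measurable (glueWith E · η) := measurable_glueWith E η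
  -- the kernel integral formula for the indicator of `A`
  have hformula : (ymSpecification ρ β E η).real A =
      (∫ ζ, A.indicator 1 (glueWith E ζ η) * w (glueWith E ζ η) ∂π) / ∫ ζ, w (glueWith E ζ η) ∂π := by
    rw [← integral_indicator_one hA]
    exact integral_ymSpecification_of_continuous ρ hρ β E (measurable_one.indicator hA) η
  -- numerator ≤ e^{-βT}
  have hnum : ∫ ζ, A.indicator 1 (glueWith E ζ η) * w (glueWith E ζ η) ∂π ≤ Real.exp (-(β * T)) := by
    have hle : ∀ ζ, A.indicator 1 (glueWith E ζ η) * w (glueWith E ζ η) ≤ Real.exp (-(β * T)) := fun ζ => by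
      by_cases hζ : glueWith E ζ η ∈ A
      · rw [Set.indicator_of_mem hζ, Pi.one_apply, one_mul, hw, Real.exp_le_exp]
        have h1 : T ≤ actionIn ρ E (glueWith E ζ η) := hζ
        have h2 := actionIn_le_wilsonBoundaryAction ρ hU E (glueWith E ζ η)
        nlinarith
      · rw [Set.indicator_of_notMem hζ, zero_mul]; exact (Real.exp_pos _).le
    have hi : Integrable (fun ζ => A.indicator 1 (glueWith E ζ η) * w (glueWith E ζ η)) π :=
      Literature.MathematicalPhysics.QuantumLattice.integrable_of_bound
        (((measurable_one.indicator hA).comp hg).mul (hwm.comp hg)).aestronglyMeasurable (C := Real.exp (-(β * T)))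
        fun ζ => by
          have h0 : 0 ≤ A.indicator 1 (glueWith E ζ η) * w (glueWith E ζ η) :=
            mul_nonneg (Set.indicator_nonneg (fun _ _ => zero_le_one) _) (Real.exp_pos _).le
          rw [abs_of_nonneg h0]
          exact hle ζ
    calc ∫ ζ, A.indicator 1 (glueWith E ζ η) * w (glueWith E ζ η) ∂π ≤ ∫ _ζ, Real.exp (-(β * T)) ∂π :=
        integral_mono hi (integrable_const _) hle
      _ = Real.exp (-(β * T)) := by simp
  -- denominator ≥ e^{-βK} m^{#E}
  set B : Set (↥E → G) := Set.pi Set.univ fun _ : ↥E => {g : G | ‖ρ g - 1‖ ≤ δ} with hB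
  have hBm : MeasurableSet B := MeasurableSet.univ_pi fun _ =>
    (isClosed_le (continuous_norm.comp (hρ.sub continuous_const)) continuous_const).measurableSet
  have hden : Real.exp (-(β * K)) * m ^ E.card ≤ ∫ ζ, w (glueWith E ζ η) ∂π := by
    have hle : ∀ ζ, B.indicator (fun _ => Real.exp (-(β * K))) ζ ≤ w (glueWith E ζ η) := fun ζ => by
      by_cases hζ : ζ ∈ B
      · rw [Set.indicator_of_mem hζ, hw, Real.exp_le_exp]
        have hδ' : ∀ e ∈ E, ‖ρ (glueWith E ζ η e) - 1‖ ≤ δ := fun e he => by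
          rw [glueWith_apply_mem E ζ η he]
          exact (Set.mem_pi.1 hζ) ⟨e, he⟩ (Set.mem_univ _)
        have h := wilsonBoundaryAction_le_of_ball ρ hU E hδ'
        rw [← hK] at h
        nlinarith
      · rw [Set.indicator_of_notMem hζ]; exact (Real.exp_pos _).le
    have hi : Integrable (fun ζ => w (glueWith E ζ η)) π := by
      refine Literature.MathematicalPhysics.QuantumLattice.integrable_of_bound (hwm.comp hg).aestronglyMeasurable (C := 1)
        fun ζ => ?_
      have h0 : 0 ≤ wilsonBoundaryAction ρ E (glueWith E ζ η) :=
        (actionIn_nonneg ρ hU E _).trans (actionIn_le_wilsonBoundaryAction ρ hU E _)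
      have h1 : w (glueWith E ζ η) ≤ 1 := by
        simp only [hw]
        rw [Real.exp_le_one_iff]
        nlinarith
      rw [abs_of_nonneg (Real.exp_pos _).le]
      exact h1
    calc Real.exp (-(β * K)) * m ^ E.card ≤ Real.exp (-(β * K)) * π.real B :=
        mul_le_mul_of_nonneg_left (pow_le_measureReal_pi_ball ρ E hm.le hball) (Real.exp_pos _).le
      _ = ∫ ζ, B.indicator (fun _ => Real.exp (-(β * K))) ζ ∂π := by
          rw [integral_indicator_const _ hBm, smul_eq_mul, mul_comm]
      _ ≤ ∫ ζ, w (glueWith E ζ η) ∂π :=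
          integral_mono ((integrable_const _).indicator hBm) hi hle
  have hden_pos : 0 < Real.exp (-(β * K)) * m ^ E.card := mul_pos (Real.exp_pos _) (pow_pos hm _)
  rw [hformula]
  calc (∫ ζ, A.indicator 1 (glueWith E ζ η) * w (glueWith E ζ η) ∂π) / ∫ ζ, w (glueWith E ζ η) ∂π
      ≤ Real.exp (-(β * T)) / (Real.exp (-(β * K)) * m ^ E.card) :=
        div_le_div₀ (Real.exp_pos _).le hnum hden_pos hden
    _ = Real.exp (β * K - β * T) / m ^ E.card := by
        rw [div_mul_eq_div_div, ← Real.exp_sub]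
        ring_nf

/-- **Kernel-level large-field rarity, `ℝ≥0∞` form.** -/
theorem kernel_apply_le_actionIn_le (hρ : Continuous ρ) (hU : ∀ g, ρ g ∈ Matrix.unitaryGroup (Fin N) ℂ)
    {β : ℝ} (hβ : 0 ≤ β) (E : Finset (ZdEdge d)) (η : LGConfig d G) {δ m : ℝ} (hm : 0 < m)
    (hball : ENNReal.ofReal m ≤ haarProbability G {g : G | ‖ρ g - 1‖ ≤ δ}) (T : ℝ) :
    ymSpecification ρ β E η {U : LGConfig d G | T ≤ actionIn ρ E U} ≤
      ENNReal.ofReal (Real.exp (β * (8 * δ ^ 2 * (plaqsIn E).card +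
          2 * N * ((plaquettesTouching E).card - (plaqsIn E).card)) - β * T) / m ^ E.card) := by
  haveI : IsFiniteMeasure (ymSpecification ρ β E η) := by
    unfold ymSpecification; infer_instance
  rw [← ofReal_measureReal (measure_ne_top _ _)]
  exact ENNReal.ofReal_le_ofReal (kernel_measureReal_le_actionIn_le ρ hρ hU hβ E η hm hball T)

/-- **Localised form (DLR consistency).**  The same bound for the large-action event of `E` read inside any larger
kernel `γ_Λ(· | ζ)`, `E ⊆ Λ`, uniformly in `ζ` (Hausdorff `G`: `ymSpecification` is a Georgii specification). -/
theorem kernel_apply_le_actionIn_le_of_subset [T2Space G] (hρ : Continuous ρ)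
    (hU : ∀ g, ρ g ∈ Matrix.unitaryGroup (Fin N) ℂ) {β : ℝ} (hβ : 0 ≤ β) {E Λ : Finset (ZdEdge d)} (hEΛ : E ⊆ Λ)
    (ζ : LGConfig d G) {δ m : ℝ} (hm : 0 < m) (hball : ENNReal.ofReal m ≤ haarProbability G {g : G | ‖ρ g - 1‖ ≤ δ})
    (T : ℝ) :
    ymSpecification ρ β Λ ζ {U : LGConfig d G | T ≤ actionIn ρ E U} ≤
      ENNReal.ofReal (Real.exp (β * (8 * δ ^ 2 * (plaqsIn E).card +
          2 * N * ((plaquettesTouching E).card - (plaqsIn E).card)) - β * T) / m ^ E.card) := by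
  have hγ := isSpecification_ymSpecification_of_t2Space (d := d) ρ hρ β
  haveI := hγ.isProbability Λ ζ
  rw [← hγ.consistent hEΛ ζ _ (measurableSet_le_actionIn ρ hρ E T)]
  calc ∫⁻ σ, ymSpecification ρ β E σ {U : LGConfig d G | T ≤ actionIn ρ E U} ∂(ymSpecification ρ β Λ ζ)
      ≤ ∫⁻ _σ, ENNReal.ofReal (Real.exp (β * (8 * δ ^ 2 * (plaqsIn E).card +
          2 * N * ((plaquettesTouching E).card - (plaqsIn E).card)) - β * T) / m ^ E.card)
            ∂(ymSpecification ρ β Λ ζ) :=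
        lintegral_mono fun σ => kernel_apply_le_actionIn_le ρ hρ hU hβ E σ hm hball T
    _ = _ := by rw [lintegral_const, measure_univ, mul_one]

/-- `measureReal` form of the localised bound. -/
theorem kernel_measureReal_le_actionIn_le_of_subset [T2Space G] (hρ : Continuous ρ)
    (hU : ∀ g, ρ g ∈ Matrix.unitaryGroup (Fin N) ℂ) {β : ℝ} (hβ : 0 ≤ β) {E Λ : Finset (ZdEdge d)} (hEΛ : E ⊆ Λ)
    (ζ : LGConfig d G) {δ m : ℝ} (hm : 0 < m) (hball : ENNReal.ofReal m ≤ haarProbability G {g : G | ‖ρ g - 1‖ ≤ δ})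
    (T : ℝ) :
    (ymSpecification ρ β Λ ζ).real {U : LGConfig d G | T ≤ actionIn ρ E U} ≤
      Real.exp (β * (8 * δ ^ 2 * (plaqsIn E).card +
          2 * N * ((plaquettesTouching E).card - (plaqsIn E).card)) - β * T) / m ^ E.card :=
  ENNReal.toReal_le_of_le_ofReal (by positivity)
    (kernel_apply_le_actionIn_le_of_subset ρ hρ hU hβ hEΛ ζ hm hball T)

end Kernel

/-! ## §4 Faithful representations: the Gaussian scale `δ = β^{-1/2}` -/

section Rep

variable {d : ℕ} {G : Type*} [Group G] [TopologicalSpace G] [IsTopologicalGroup G] [CompactSpace G]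
  [MeasurableSpace G] [BorelSpace G] [SecondCountableTopology G] [T2Space G]

/-- **Kernel-level large-field rarity for a faithful lattice representation, Gaussian scale.**  There is
`C₁ = C₁(r) > 0` such that for all `β ≥ 1`, all finite `E ⊆ Λ`, every exterior `ζ` and every `T`,
`γ_Λ(· | ζ){T ≤ actionIn r.ρ E} ≤ exp(8 n_in + 2Nβ n_bd − βT) / (C₁ β^{−D/2})^{#E}` with `D = dimE r.ρ`
(`δ = β^{-1/2}` in `kernel_measureReal_le_actionIn_le_of_subset`, small-ball constant from `exists_haar_gball_ge`). -/
theorem kernel_measureReal_le_actionIn_le_rep (r : LatticeRep G) :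
    ∃ C₁ : ℝ, 0 < C₁ ∧ ∀ (β : ℝ), 1 ≤ β → ∀ (E Λ : Finset (ZdEdge d)), E ⊆ Λ → ∀ (ζ : LGConfig d G) (T : ℝ),
      (ymSpecification r.ρ β Λ ζ).real {U : LGConfig d G | T ≤ actionIn r.ρ E U} ≤
        Real.exp (8 * (plaqsIn E).card + 2 * r.N * β * ((plaquettesTouching E).card - (plaqsIn E).card) - β * T) /
          (C₁ * (Real.sqrt β)⁻¹ ^ dimE r.ρ) ^ E.card := by
  obtain ⟨C₁, hC₁, hball⟩ := exists_haar_gball_ge r.ρ r.continuous r.injective r.mem_unitary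
  refine ⟨C₁, hC₁, fun β hβ E Λ hEΛ ζ T => ?_⟩
  have hβ0 : 0 < β := by linarith
  have hs : 0 < Real.sqrt β := Real.sqrt_pos.2 hβ0
  have hδ : 0 < (Real.sqrt β)⁻¹ := inv_pos.2 hs
  have hδ1 : (Real.sqrt β)⁻¹ ≤ 1 := inv_le_one_of_one_le₀ (Real.one_le_sqrt.2 hβ)
  have hm : 0 < C₁ * (Real.sqrt β)⁻¹ ^ dimE r.ρ := mul_pos hC₁ (pow_pos hδ _)
  have h := kernel_measureReal_le_actionIn_le_of_subset r.ρ r.continuous r.mem_unitary hβ0.le hEΛ ζ hm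
    (hball _ hδ hδ1) T
  have hδ2 : β * (8 * (Real.sqrt β)⁻¹ ^ 2 * (plaqsIn E).card) = 8 * (plaqsIn E).card := by
    rw [inv_pow, Real.sq_sqrt hβ0.le]
    field_simp
  refine h.trans_eq ?_
  congr 1
  rw [mul_add, hδ2]
  ring_nf

end Rep

end Summit.QuantumFields.YangMills.Theorems.IRKernelLargeField

end
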